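import Mathlib.Analysis.SpecialFunctions.SmoothTransition
import Mathlib.Analysis.SpecialFunctions.Integrals.Basic
import Mathlib.Analysis.SpecialFunctions.Trigonometric.Series
import Mathlib.Analysis.Complex.Exponential
import Mathlib.MeasureTheory.Integral.IntervalIntegral.Basic

/-!
# Second-order cell bounds for the integrals of the fixed bump `φ₀(u) = expNegInvGlue (1 − u²)`
(crux `WeilComb.CombShapePositivity`, item stmt-RiemannHypothesis-11229, line `Sketch`, towards `stub_windowCore`:
interval-certificate infrastructure for the constants `I₀ = ∫ φ₀`, `N₀ = ‖φ₀‖₂²` of the band budget)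

On `[0, 1)` write `φ₀(u) = e^{g(u)}`, `g(u) = −(1 − u²)⁻¹`. The function `g` is CONCAVE, with the explicit tangent
inequality `g(v) ≤ g(u) + g'(u)(v − u)` (`negInv_tangent`: the defect is `(v−u)²(1 + 2uv + u²)/((1−v²)(1−u²)²) ≥ 0`),
hence the chord inequality (`negInv_chord`). Consequences, for a cell `[a, a+h] ⊂ [0, 1)` with midpoint `c`:

* `cell_integral_shapeBump_le` — `∫_a^{a+h} φ₀ ≤ h · exp(g(c) + (δh/2)²/2)`, `δ = −g'(c) = 2c/(1−c²)²`
  (tangent majorant `e^{g(c) − δ(u−c)}`, convexity of `exp` along the cell (chord), `cosh s ≤ e^{s²/2}`);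
* `le_cell_integral_shapeBump_sq` — `h · exp(g(a) + g(a+h)) ≤ ∫_a^{a+h} φ₀²` (chord minorant of `g`, tangent line of
  `exp` at `g(a)+g(b)`; a "geometric-mean rule").
Both are second-order accurate, so a dozen cells certify `I₀`, `N₀` to three digits. The numerical evaluation of the
exponentials at rational points is reduced to rational arithmetic by `exp_le_pow_eight` / `pow_eight_le_exp`
(`e^y = (e^{y/8})⁸` and the degree-5 Taylor polynomial with the remainder of `Real.exp_bound`).
-/

noncomputable section

-- the sub-problem path `RiemannHypothesis/RiemannHypothesis` (single-conjunct summit, D-0017) duplicates a namespace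
set_option linter.dupNamespace false

open Real MeasureTheory Set intervalIntegral

namespace Summit.RiemannHypothesis.RiemannHypothesis.Theorems.WeilCombBohrFejer

/-! ## Exponentials at rational points: `e^y` against `(Taylor₅(x) ± |x|⁶·7/4320)⁸`, `y ≈ 8x` -/

/-- The degree-5 Taylor sum of `exp` at `x`. [folklore] -/
private theorem sum_range_six_taylor (x : ℝ) :
    ∑ m ∈ Finset.range 6, x ^ m / (m.factorial : ℝ) =
      1 + x + x ^ 2 / 2 + x ^ 3 / 6 + x ^ 4 / 24 + x ^ 5 / 120 := by
  simp only [Finset.sum_range_succ, Finset.sum_range_zero, Nat.factorial]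
  push_cast
  ring

/-- **Upper exponential bound by rational arithmetic.** If `y ≤ 8x`, `|x| ≤ 1`,
`Taylor₅(x) + |x|⁶·7/4320 ≤ w` and `w⁸ ≤ R` then `e^y ≤ R`. [folklore] -/
theorem exp_le_pow_eight {y x w R : ℝ} (hyx : y ≤ 8 * x) (hx : |x| ≤ 1)
    (hw : 1 + x + x ^ 2 / 2 + x ^ 3 / 6 + x ^ 4 / 24 + x ^ 5 / 120 + |x| ^ 6 * (7 / 4320) ≤ w)
    (hR : w ^ 8 ≤ R) : Real.exp y ≤ R := by
  have hb := Real.exp_bound hx (n := 6) (by norm_num)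
  rw [sum_range_six_taylor] at hb
  norm_num [Nat.factorial] at hb
  have hexp : Real.exp x ≤ w := by
    have := (abs_le.1 hb).2
    linarith
  calc Real.exp y ≤ Real.exp (8 * x) := Real.exp_le_exp.2 hyx
    _ = Real.exp x ^ 8 := by rw [← Real.exp_nat_mul]; norm_num
    _ ≤ w ^ 8 := pow_le_pow_left₀ (Real.exp_pos x).le hexp 8
    _ ≤ R := hR

/-- **Lower exponential bound by rational arithmetic.** If `8x ≤ y`, `|x| ≤ 1`, `0 ≤ w`,
`w ≤ Taylor₅(x) − |x|⁶·7/4320` and `R ≤ w⁸` then `R ≤ e^y`. [folklore] -/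
theorem pow_eight_le_exp {y x w R : ℝ} (hxy : 8 * x ≤ y) (hx : |x| ≤ 1) (hw0 : 0 ≤ w)
    (hw : w ≤ 1 + x + x ^ 2 / 2 + x ^ 3 / 6 + x ^ 4 / 24 + x ^ 5 / 120 - |x| ^ 6 * (7 / 4320))
    (hR : R ≤ w ^ 8) : R ≤ Real.exp y := by
  have hb := Real.exp_bound hx (n := 6) (by norm_num)
  rw [sum_range_six_taylor] at hb
  norm_num [Nat.factorial] at hb
  have hexp : w ≤ Real.exp x := by
    have := (abs_le.1 hb).1
    linarith
  calc R ≤ w ^ 8 := hR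
    _ ≤ Real.exp x ^ 8 := pow_le_pow_left₀ hw0 hexp 8
    _ = Real.exp (8 * x) := by rw [← Real.exp_nat_mul]; norm_num
    _ ≤ Real.exp y := Real.exp_le_exp.2 hxy

/-! ## The concave exponent `g(u) = −(1 − u²)⁻¹` -/

/-- Tangent inequality of the concave `g(u) = −(1 − u²)⁻¹` on `[0, 1)`:
`g(v) ≤ g(u) + g'(u)(v − u)`, `g'(u) = −2u/(1−u²)²`. [folklore] -/
theorem negInv_tangent {u v : ℝ} (hu0 : 0 ≤ u) (hu1 : u < 1) (hv0 : 0 ≤ v) (hv1 : v < 1) :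
    -(1 - v ^ 2)⁻¹ ≤ -(1 - u ^ 2)⁻¹ - 2 * u / (1 - u ^ 2) ^ 2 * (v - u) := by
  have hu' : 0 < 1 - u ^ 2 := by nlinarith
  have hv' : 0 < 1 - v ^ 2 := by nlinarith
  rw [← sub_nonneg]
  have key : -(1 - u ^ 2)⁻¹ - 2 * u / (1 - u ^ 2) ^ 2 * (v - u) - -(1 - v ^ 2)⁻¹ =
      (v - u) ^ 2 * (1 + 2 * u * v + u ^ 2) / ((1 - v ^ 2) * (1 - u ^ 2) ^ 2) := by
    field_simp
    ring
  rw [key]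
  apply div_nonneg
  · exact mul_nonneg (sq_nonneg _) (by nlinarith)
  · positivity

/-- Chord inequality of the concave `g(u) = −(1 − u²)⁻¹`: for `0 ≤ a ≤ u ≤ b < 1`,
`(b − u) g(a) + (u − a) g(b) ≤ (b − a) g(u)`. [folklore] -/
theorem negInv_chord {a b u : ℝ} (ha0 : 0 ≤ a) (hau : a ≤ u) (hub : u ≤ b) (hb1 : b < 1) :
    (b - u) * (-(1 - a ^ 2)⁻¹) + (u - a) * (-(1 - b ^ 2)⁻¹) ≤ (b - a) * (-(1 - u ^ 2)⁻¹) := by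
  have h1 := negInv_tangent (u := u) (v := a) (by linarith) (by linarith) ha0 (by linarith)
  have h2 := negInv_tangent (u := u) (v := b) (by linarith) (by linarith) (by linarith) hb1
  have hbu : 0 ≤ b - u := by linarith
  have hua : 0 ≤ u - a := by linarith
  have h3 := add_le_add (mul_le_mul_of_nonneg_left h1 hbu) (mul_le_mul_of_nonneg_left h2 hua)
  have e : (b - u) * (-(1 - u ^ 2)⁻¹ - 2 * u / (1 - u ^ 2) ^ 2 * (a - u)) +
      (u - a) * (-(1 - u ^ 2)⁻¹ - 2 * u / (1 - u ^ 2) ^ 2 * (b - u)) = (b - a) * (-(1 - u ^ 2)⁻¹) := by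
    ring
  linarith

/-! ## The bump on `[0, 1)` -/

/-- On `u² < 1` the bump is `e^{−(1−u²)⁻¹}`. [folklore] -/
theorem expNegInvGlue_one_sub_sq {u : ℝ} (hu : u ^ 2 < 1) :
    expNegInvGlue (1 - u ^ 2) = Real.exp (-(1 - u ^ 2)⁻¹) := by
  have h : ¬ (1 - u ^ 2 ≤ 0) := not_le.2 (by linarith)
  simp [expNegInvGlue, h]

/-- The bump is continuous. [folklore] -/
theorem continuous_shapeBump : Continuous fun u : ℝ => expNegInvGlue (1 - u ^ 2) :=
  (expNegInvGlue.contDiff (n := 0)).continuous.comp (continuous_const.sub (continuous_id.pow 2))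

/-- The bump is non-increasing on `[0, ∞)`. [folklore] -/
theorem shapeBump_antitone {u v : ℝ} (hu : 0 ≤ u) (huv : u ≤ v) :
    expNegInvGlue (1 - v ^ 2) ≤ expNegInvGlue (1 - u ^ 2) :=
  expNegInvGlue.monotone (by nlinarith)

/-- The integral of an affine function over a cell. [folklore] -/
private theorem integral_affine (a b p q : ℝ) :
    ∫ u in a..b, (p * u + q) = p * ((b ^ 2 - a ^ 2) / 2) + q * (b - a) := by
  have h1 : IntervalIntegrable (fun u : ℝ => p * u) volume a b :=
    (by fun_prop : Continuous fun u : ℝ => p * u).intervalIntegrable a b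
  have h2 : IntervalIntegrable (fun _ : ℝ => q) volume a b := continuous_const.intervalIntegrable a b
  rw [intervalIntegral.integral_add h1 h2, intervalIntegral.integral_const_mul, integral_id,
    intervalIntegral.integral_const, smul_eq_mul]
  ring

/-- **Cell upper bound for `∫ φ₀` (tangent of `g`, chord of `exp`, `cosh s ≤ e^{s²/2}`).** For `0 ≤ a`, `0 < h`,
`a + h < 1`, with `c = a + h/2` and `δ = 2c/(1 − c²)²`:
`∫_a^{a+h} φ₀ ≤ h · exp(−(1 − c²)⁻¹ + (δh/2)²/2)`. [folklore] -/
theorem cell_integral_shapeBump_le : ∀ {a h : ℝ}, 0 ≤ a → 0 < h → a + h < 1 →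
    ∫ u in a..a + h, expNegInvGlue (1 - u ^ 2) ≤
      h * Real.exp (-(1 - (a + h / 2) ^ 2)⁻¹ +
        (2 * (a + h / 2) / (1 - (a + h / 2) ^ 2) ^ 2 * h / 2) ^ 2 / 2) := by
  intro a h ha hh hb
  set c : ℝ := a + h / 2 with hc
  set γ : ℝ := -(1 - c ^ 2)⁻¹ with hγ
  set δ : ℝ := 2 * c / (1 - c ^ 2) ^ 2 with hδ
  set s : ℝ := δ * h / 2 with hs
  set P : ℝ := Real.exp (γ + s) with hP
  set Q : ℝ := Real.exp (γ - s) with hQ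
  have hc0 : 0 ≤ c := by rw [hc]; positivity
  have hc1 : c < 1 := by rw [hc]; linarith
  -- pointwise majorant on the cell
  have hpt : ∀ u ∈ Icc a (a + h), expNegInvGlue (1 - u ^ 2) ≤ ((Q - P) / h) * u + (((a + h) * P - a * Q) / h) := by
    intro u hu
    have hu0 : 0 ≤ u := ha.trans hu.1
    have hu1 : u < 1 := lt_of_le_of_lt hu.2 hb
    have husq : u ^ 2 < 1 := by nlinarith
    rw [expNegInvGlue_one_sub_sq husq]
    -- tangent majorant of `g`
    have htan : -(1 - u ^ 2)⁻¹ ≤ γ - δ * (u - c) := by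
      have := negInv_tangent hc0 hc1 hu0 hu1
      rw [hγ, hδ]; linarith
    -- the tangent value as a convex combination of its endpoint values
    set t : ℝ := (u - a) / h with ht
    have ht0 : 0 ≤ t := by rw [ht]; exact div_nonneg (by linarith [hu.1]) hh.le
    have ht1 : t ≤ 1 := by rw [ht, div_le_one hh]; linarith [hu.2]
    have hcomb : γ - δ * (u - c) = (1 - t) * (γ + s) + t * (γ - s) := by
      rw [ht, hs, hc]; field_simp; ring
    have hconv : Real.exp ((1 - t) * (γ + s) + t * (γ - s)) ≤ (1 - t) * Real.exp (γ + s) + t * Real.exp (γ - s) := by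
      have := convexOn_exp.2 (Set.mem_univ (γ + s)) (Set.mem_univ (γ - s)) (by linarith : 0 ≤ 1 - t) ht0
        (by ring)
      simpa only [smul_eq_mul] using this
    have hlin : (1 - t) * Real.exp (γ + s) + t * Real.exp (γ - s) =
        ((Q - P) / h) * u + (((a + h) * P - a * Q) / h) := by
      rw [hP, hQ, ht]; field_simp; ring
    calc Real.exp (-(1 - u ^ 2)⁻¹) ≤ Real.exp (γ - δ * (u - c)) := Real.exp_le_exp.2 htan
      _ = Real.exp ((1 - t) * (γ + s) + t * (γ - s)) := by rw [hcomb]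
      _ ≤ (1 - t) * Real.exp (γ + s) + t * Real.exp (γ - s) := hconv
      _ = ((Q - P) / h) * u + (((a + h) * P - a * Q) / h) := hlin
  -- integrate
  have hcont2 : Continuous fun u : ℝ => ((Q - P) / h) * u + (((a + h) * P - a * Q) / h) := by fun_prop
  have hint := intervalIntegral.integral_mono_on (by linarith)
    (continuous_shapeBump.intervalIntegrable (μ := volume) a (a + h))
    (hcont2.intervalIntegrable (μ := volume) a (a + h)) hpt
  have hval : ∫ u in a..a + h, (((Q - P) / h) * u + (((a + h) * P - a * Q) / h)) = h * ((P + Q) / 2) := by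
    rw [integral_affine]; field_simp; ring
  rw [hval] at hint
  -- `(P + Q)/2 = e^γ cosh s ≤ e^{γ + s²/2}`
  have hcosh : (P + Q) / 2 ≤ Real.exp (γ + s ^ 2 / 2) := by
    have e1 : (P + Q) / 2 = Real.exp γ * Real.cosh s := by
      rw [hP, hQ, Real.cosh_eq, Real.exp_add, sub_eq_add_neg, Real.exp_add]; ring
    rw [e1, Real.exp_add]
    exact mul_le_mul_of_nonneg_left (Real.cosh_le_exp_half_sq s) (Real.exp_pos γ).le
  calc ∫ u in a..a + h, expNegInvGlue (1 - u ^ 2) ≤ h * ((P + Q) / 2) := hint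
    _ ≤ h * Real.exp (γ + s ^ 2 / 2) := mul_le_mul_of_nonneg_left hcosh hh.le

/-- **Cell lower bound for `∫ φ₀²` (chord of `g`, tangent of `exp`).** For `0 ≤ a`, `0 < h`, `a + h < 1`:
`h · exp(−(1 − a²)⁻¹ − (1 − (a+h)²)⁻¹) ≤ ∫_a^{a+h} φ₀²`. [folklore] -/
theorem le_cell_integral_shapeBump_sq : ∀ {a h : ℝ}, 0 ≤ a → 0 < h → a + h < 1 →
    h * Real.exp (-(1 - a ^ 2)⁻¹ + -(1 - (a + h) ^ 2)⁻¹) ≤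
      ∫ u in a..a + h, expNegInvGlue (1 - u ^ 2) ^ 2 := by
  intro a h ha hh hb
  set b : ℝ := a + h with hbdef
  set ga : ℝ := -(1 - a ^ 2)⁻¹ with hga
  set gb : ℝ := -(1 - b ^ 2)⁻¹ with hgb
  set y0 : ℝ := ga + gb with hy0
  -- pointwise minorant: `φ₀(u)² ≥ e^{y0} (1 + 2ℓ(u) − y0)`, `ℓ(u) = ((b−u) ga + (u−a) gb)/h`
  have hpt : ∀ u ∈ Icc a b, Real.exp y0 * (2 * (gb - ga) / h) * u +
      Real.exp y0 * (1 + (2 * (b * ga - a * gb) / h - y0)) ≤ expNegInvGlue (1 - u ^ 2) ^ 2 := by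
    intro u hu
    have hu0 : 0 ≤ u := ha.trans hu.1
    have hu1 : u < 1 := lt_of_le_of_lt hu.2 hb
    have husq : u ^ 2 < 1 := by nlinarith
    rw [expNegInvGlue_one_sub_sq husq, ← Real.exp_nat_mul]
    push_cast
    -- chord minorant of `g`
    have hch := negInv_chord ha hu.1 hu.2 hb
    have hℓ : (2 * (gb - ga) / h) * u + 2 * (b * ga - a * gb) / h ≤ 2 * -(1 - u ^ 2)⁻¹ := by
      rw [hga, hgb]
      have hh' : (0 : ℝ) < b - a := by rw [hbdef]; linarith
      have e : (2 * (-(1 - b ^ 2)⁻¹ - -(1 - a ^ 2)⁻¹) / h) * u + 2 * (b * -(1 - a ^ 2)⁻¹ - a * -(1 - b ^ 2)⁻¹) / h =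
          (2 / h) * ((b - u) * (-(1 - a ^ 2)⁻¹) + (u - a) * (-(1 - b ^ 2)⁻¹)) := by
        field_simp; ring
      rw [e]
      have hba : b - a = h := by rw [hbdef]; ring
      rw [hba] at hch
      have := mul_le_mul_of_nonneg_left hch (by positivity : (0 : ℝ) ≤ 2 / h)
      calc 2 / h * ((b - u) * -(1 - a ^ 2)⁻¹ + (u - a) * -(1 - b ^ 2)⁻¹) ≤ 2 / h * (h * -(1 - u ^ 2)⁻¹) := this
        _ = 2 * -(1 - u ^ 2)⁻¹ := by field_simp
    -- tangent line of `exp` at `y0`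
    have htan : Real.exp y0 * (1 + ((2 * (gb - ga) / h) * u + 2 * (b * ga - a * gb) / h - y0)) ≤
        Real.exp ((2 * (gb - ga) / h) * u + 2 * (b * ga - a * gb) / h) := by
      have h1 := Real.add_one_le_exp ((2 * (gb - ga) / h) * u + 2 * (b * ga - a * gb) / h - y0)
      have h2 := mul_le_mul_of_nonneg_left h1 (Real.exp_pos y0).le
      rw [← Real.exp_add] at h2
      have e : y0 + ((2 * (gb - ga) / h) * u + 2 * (b * ga - a * gb) / h - y0) =
          (2 * (gb - ga) / h) * u + 2 * (b * ga - a * gb) / h := by ring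
      rw [e] at h2
      linarith
    calc Real.exp y0 * (2 * (gb - ga) / h) * u + Real.exp y0 * (1 + (2 * (b * ga - a * gb) / h - y0))
        = Real.exp y0 * (1 + ((2 * (gb - ga) / h) * u + 2 * (b * ga - a * gb) / h - y0)) := by ring
      _ ≤ Real.exp ((2 * (gb - ga) / h) * u + 2 * (b * ga - a * gb) / h) := htan
      _ ≤ Real.exp (2 * -(1 - u ^ 2)⁻¹) := Real.exp_le_exp.2 hℓ
  have hsq_cont : Continuous fun u : ℝ => expNegInvGlue (1 - u ^ 2) ^ 2 := continuous_shapeBump.pow 2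
  have hcont1 : Continuous fun u : ℝ => Real.exp y0 * (2 * (gb - ga) / h) * u +
      Real.exp y0 * (1 + (2 * (b * ga - a * gb) / h - y0)) := by fun_prop
  have hint := intervalIntegral.integral_mono_on (by rw [hbdef]; linarith)
    (hcont1.intervalIntegrable (μ := volume) a b)
    (hsq_cont.intervalIntegrable (μ := volume) a b) hpt
  have hval : ∫ u in a..b, (Real.exp y0 * (2 * (gb - ga) / h) * u +
      Real.exp y0 * (1 + (2 * (b * ga - a * gb) / h - y0))) = h * Real.exp y0 := by
    rw [integral_affine, hy0, hbdef]; field_simp; ring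
  rw [hval] at hint
  rw [hy0, hga, hgb] at hint
  exact hint

end Summit.RiemannHypothesis.RiemannHypothesis.Theorems.WeilCombBohrFejer

end
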